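import Summits.BirchSwinnertonDyer.Rank1Residual.O5.HeegnerLogTransportThreeChain
import Summits.BirchSwinnertonDyer.BirchSwinnertonDyer.Theorems.ClassRecordThreeCornerTwistWitnessReplays
import Literature.NumberTheory.EllipticCurves.LFunctionPrimeCoeffMultiplicative
import HarnessLib

/-!
# Crux idea (item stmt-BirchSwinnertonDyer-21420 `ClassRecordThree.CornerAtThreeW`, t0 = `3 ∤ ∏_ℓ c_ℓ(E)`):
# Kriz–Li COMPANION transport of the Heegner-log unit bit at multiplicative `3` (cell `bsd-stepL`, seat `mult-idea` g13)

PLANNER SKETCH — elaborates on the farm, `sorry`-free; NOT a proposal, NOT a Theorems file; nothing is booked;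
item 21420 does NOT close. Card: `Cruxes/CornerAtThreeW/Ideas/companion-log-transport-on-t0-at-3.md` (to be filed by
@plan, TURNKEY T-g13-1; this unit's `ledger idea add --crux` ∕ `crux write` are one-writer refused).

## The line in one paragraph

On the (T4″)₃ corner (`(E,3) ∈` X11b, `ρ̄_{E,3}` onto `N(C)`), the Tamagawa-free locus t0 (`3 ∤ ∏c(E)`, 88 ∕ 296 LMFDB
pairs `N < 5·10⁵`) is where the crux `CornerAtThreeW` = (L) ∧ (W) ∧ (U′) reduces to ONE odd Heegner frame `K` with a
UNIT twin value `L(E^{d_K},1)/Ω` (card F's K1, census 88∕88, `|d_K| ≤ 1319`) AND a UNIT Heegner index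
`3 ∤ [E(K):ℤP_K]` (m0): §1 `WitnessWithUnitIndexAt`; §3 proves it feeds the corner's `Typed.MissingPPartAt W 3`
through the tree's replayed consumer with (L) = `CornerStepLAt` REPLACED by the unit index at the witness frame
(`missingPPartAt_of_witnessWithUnitIndex`). On t0 every multiplicative prime of `E` is NON-SPLIT with `3 ∣ v_ℓ(Δ)`
(image order `16` prime to `3`; tree `three_dvd_tamagawaProduct_of_corner_split`), so `E[3]` is finite at `3`,
unramified at every other multiplicative prime, and `ρ̄` has a weight-2 COMPANION `g₀` of level `N_add ∣ N/3`, GOOD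
ordinary non-anomalous at `3` (`a_3(g₀) ≡ a_3(E) = −1`). LEVER: Kriz–Li's congruence of `3`-adic Heegner logarithms
(Forum Math. Sigma 7 (2019) e15, Thm. 1.16 ∕ GL₂-type Thm. 3.9, `m = 1`, ANY reduction type at `p`: tree fact A314
`KrizLi2019.thm116_padicLogHeegner_congruence`, typed at `p = 3` by cell O5 as KL3-A `KrizLiUnitBitTransportThree`)
transports the UNIT BIT of the normalised log between `E` (multiplicative non-split `3`: Kriz–Li exponent `−1`, unit bit
⟺ `ord₃ log_ω P = 1`, §2 `padicLogOrd_eq_one_of_companion_unit_of_nonsplit`) and an elliptic companion `G` GOOD at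
`3` congruent to `E` off `3·N_E·N_G`; at a non-split `3` with `3 ∤ c₃` and `E(K)[3] = 0` the bit `ord₃ log_ω P = 1`
IS local `3`-indivisibility, hence `3 ∤ [E(K):ℤP]` (§2 `padicValNat_index_eq_zero_of_companion_unit_of_nonsplit`, the
multiplicative twin of O5's additive L1 on X11b's `exists_addEquiv_valuation_psi_padicPointOf`). So on t0 the whole
open content of the crux moves to the COMPANION side at GOOD ordinary `3`: §1 `CompanionUnitBitAt` (K2, the located
residual; in print only for `p ≥ 5` with image `⊇ SL₂`; at `p = 3` open even for surjective image — O5's KL3-D wall).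
Honest scope: Kriz–Li is void at a multiplicative `ℓ ≠ 3`, `ℓ ≡ 2 (mod 3)` of `E` (factor `(ℓ+1)/ℓ`), and the bit
detects m0 only when `E(ℚ)`'s generator is `3`-indivisible in `E(ℚ₃)` (hypothesis (iv), as in O5's KL3-C♭).
Beyond-print theorem: NO. Nothing here uses `Surj`; every image-sensitive input is a named hypothesis.

References: [KrizLi2019] Thm. 1.16, Rem. 1.17, Rem. 3.10, §1.6 (arXiv:1606.03172); [Castella2018] §2.2, proof of
Thm. 2.3 (arXiv:1704.06608 pp. 5–6); [JetchevSkinnerWan2017] §7.4.1–7.4.2 (pp. 30–31), (7.1.5); [GrossLMS1991]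
Conj. 1.2, (2.2); [MatarNekovar2019] Thm. 0.3; [Miller2011LMS] Def. 1.1; tree: O5 `HeegnerLogTransportThree{,Chain,
Targets}.lean` (o5-r2 GEN 16), `ClassRecordThreeCornerTwistWitnessReplays.lean` l. 92 ∕ 198, HOME
`corner/mult-idea-g12/Sketch.lean` (card O, the upper branch on t0 copied verbatim).
-/

noncomputable section

open scoped Classical

open WeierstrassCurve NumberField IsDedekindDomain Field Literature.NumberTheory.EllipticCurves
  Rat.HeightOneSpectrum
  Literature.NumberTheory.DiophantineGeometry
  Literature.NumberTheory.EllipticCurves.GreenbergSelmer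
  Literature.NumberTheory.EllipticCurves.ModularForms
  Literature.NumberTheory.EllipticCurves.Rank1Residual
  Literature.NumberTheory.EllipticCurves.Rank1Residual.Typed
  Literature.NumberTheory.EllipticCurves.Wuthrich2014
  Literature.NumberTheory.EllipticCurves.BalakrishnanEtAl2019
  Literature.NumberTheory.QuadraticFields.Quadratic
  Literature.NumberTheory.Automorphic
  Literature.NumberTheory.GaloisRepresentations Literature.NumberTheory.GaloisCohomology
  Summit.BirchSwinnertonDyer.Rank1Residual.X11b.AcSelmer
  Summit.BirchSwinnertonDyer.Rank1Residual.X11b.LocBridge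
  Summit.BirchSwinnertonDyer.Rank1Residual
  Summit.BirchSwinnertonDyer.Rank1Residual.X11b
  Summit.BirchSwinnertonDyer.Rank1Residual.X11b.Three
  Summit.BirchSwinnertonDyer.BirchSwinnertonDyer.Theorems
  Summit.BirchSwinnertonDyer.BirchSwinnertonDyer.Theorems.CornerTwistWitness

open Summit.BirchSwinnertonDyer.Rank1Residual.O5.HeegnerLogTransport
open Summit.BirchSwinnertonDyer.Rank1Residual.X11b (padicLogOrd embAt padicPointOf)
open Summit.BirchSwinnertonDyer.Rank1Residual.X11b.LocalIndex (psi
  exists_addEquiv_valuation_psi_padicPointOf valuation_psi_zsmul_add)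
open Summit.BirchSwinnertonDyer.Rank1Residual.X11b.LocalTorsion (reductionPointCount_of_mult)

set_option linter.dupNamespace false

namespace Summit.BirchSwinnertonDyer.BirchSwinnertonDyer.Cruxes.CornerAtThreeW.CompanionLogTransport

/-! ### §1. The statements -/

/-- **m0 at a field `K`** — every Manin-good parametrised Heegner point of `E` over `K` (level `N_E`) generates a
subgroup of index prime to `3` (`ord₃ [E(K):ℤP] = 0`; the junk index `0` of an infinite-index subgroup has valuation
`0` and is excluded downstream by Gross–Zagier). [cite: GrossLMS1991, Conj. 1.2 (shape)] -/
def UnitIndexAt (W : WeierstrassCurve ℚ) [W.IsElliptic] [W.IsGloballyMinimal]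
    (K : Type) [Field K] [NumberField K] : Prop :=
  ∀ (N : ℕ) [NeZero N] (Dt : ModularParametrizationData W N) (H : HeegnerDatum N (NumberField.discr K))
    (ι : K →+* ℂ) (P : (W.baseChange K).toAffine.Point),
    W.conductorNorm ℤ = N → WeierstrassCurve.Affine.Point.map ι.toRatAlgHom P = heegnerPointComplex Dt H →
    ¬ (3 : ℤ) ∣ Dt.c → padicValNat 3 (AddSubgroup.zmultiples P).index = 0

/-- **The t0 form of the crux: ONE doubly-unit odd Heegner frame** — for a corner pair with `3 ∤ ∏c(E)`, SOME
imaginary quadratic `K` (`d_K` odd, `d_K < -4`, Heegner for `N_E` and for `3`, `L(E^{d_K},1) ≠ 0`) with a globally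
minimal twist model `Wd` satisfying `BSDp Wd 3` (the body of `CornerTwistWitnessAt W`, conjunct (W)) AND `UnitIndexAt W K`
(m0; replaces conjunct (L) on t0, §3). Gross–Zagier bookkeeping `2·ord₃[E(K):ℤP] = ord₃ Ш_an(E) + ord₃ Ш_an(E^{d_K}) +
2·ord₃ ∏c(E)` makes every unit-twin frame an m0 frame once `BSD₃(E)` holds, so on t0 this is predicted at card F's
certified frames (88∕88). OPEN; per-pair certifiable; NO class-wide source. [cite: Miller2011LMS, Def. 1.1 (shape)]
[cite: GrossZagier1986, V.(2.2) (shape)] -/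
def WitnessWithUnitIndexAt (W : WeierstrassCurve ℚ) [W.IsElliptic] [W.IsGloballyMinimal] : Prop :=
  ClassX11b W 3 → ¬ Surj W 3 → ¬ 3 ∣ W.tamagawaProduct →
    ∃ (K : Type) (_ : Field K) (_ : NumberField K)
      (Wd : WeierstrassCurve ℚ) (_ : Wd.IsElliptic) (_ : Wd.IsGloballyMinimal) (Cd : VariableChange ℚ),
      IsImaginaryQuadratic K ∧ Odd (NumberField.discr K) ∧ NumberField.discr K < -4 ∧
        SatisfiesHeegnerHypothesis (W.conductorNorm ℤ) K ∧ SatisfiesHeegnerHypothesis 3 K ∧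
        (W.quadraticTwist (NumberField.discr K : ℚ)).entireLFunction 1 ≠ 0 ∧
        Cd • W.quadraticTwist (NumberField.discr K : ℚ) = Wd ∧ BSDp Wd 3 ∧ UnitIndexAt W K

/-- **K2 (the located residual, companion side): the unit bit of the companion's Heegner log at `K`.** For a globally
minimal elliptic `G/ℚ` and an embedding `ι₃ : K → ℚ₃`: every Manin-unit parametrised Heegner point `P′ ∈ G(K)` of
infinite order has `ord₃ log_{ω_G} P′ + ord₃(4 − a_3(G)) − 1 = 0` (Kriz–Li's normalisation; for `G` GOOD ordinary
non-anomalous at `3` this reads `ord₃ log_{ω_G} P′ = 1`, i.e. `|G̃(𝔽₃)|·P′ ∉ Ĝ(9ℤ₃)`). The shape of O5's KL3-D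
`GoodHeegnerLogUnitThree` conclusion; in print (as a `p`-converse ∕ BDP-unit statement) only for `p ≥ 5` and image
`⊇ SL₂(ℤ_p)`; at `p = 3` with image `N(C)` NO source. A predicate; nothing asserted.
[cite: KrizLi2019, Thm. 1.16, Rem. 1.17 (normalisation)] [cite: BertoliniDarmonPrasanna2013, Thm. 5.13 (shape)] -/
def CompanionUnitBitAt (G : WeierstrassCurve ℚ) [G.IsElliptic] [G.IsGloballyMinimal]
    (K : Type) [Field K] [NumberField K] (ι₃ : K →+* ℚ_[3]) : Prop :=
  ∀ (N' : ℕ) [NeZero N'] (D' : ModularParametrizationData G N') (H' : HeegnerDatum N' (NumberField.discr K))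
    (ι : K →+* ℂ) (P' : (G.baseChange K).toAffine.Point),
    WeierstrassCurve.Affine.Point.map ι.toRatAlgHom P' = heegnerPointComplex D' H' → ¬ IsOfFinAddOrder P' →
    padicValInt 3 D'.maninConstant = 0 →
    padicLogOrd G 3 ι₃ P' + padicValInt 3 (nsCount G 3) - 1 = 0

/-- **A Kriz–Li companion of the corner curve at `3`** (support ∕ per-pair data): a globally minimal elliptic `G/ℚ`
GOOD at `3`, congruent to `W` mod `3` off `3·N_W·N_G` (`a_ℓ(W) ≡ a_ℓ(G)`), with Kriz–Li's off-`3` depletion factors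
`|W̃^{ns}(𝔽_ℓ)|`, `|G̃^{ns}(𝔽_ℓ)|` units on both sides (excludes a multiplicative `ℓ ≡ 2 (mod 3)`, `ℓ ≠ 3`, of `W`)
and `3 ∤ 4 − a_3(G)` (non-anomalous). Level-lowering supplies a companion NEWFORM of level `N_add` always (Ribet; `E[3]`
finite at `3` and unramified at the other multiplicative primes on the corner); a RATIONAL one (an elliptic curve) is
per-pair data — the GL₂-type version of the transport is Kriz–Li Thm. 3.9 (definition request D1). [cite: KrizLi2019,
Thm. 1.16, Thm. 3.9] [cite: Ribet1990, Thm. 1.1 (existence of the level-`N_add` companion; shape)] -/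
def IsKLCompanionAtThree (W G : WeierstrassCurve ℚ) [W.IsElliptic] [G.IsElliptic] : Prop :=
  ¬ ((3 : ℤ) ∣ G.conductorNorm ℤ) ∧
    (∀ ℓ : ℕ, ℓ.Prime → ¬ (ℓ ∣ 3 * W.conductorNorm ℤ * G.conductorNorm ℤ) →
      ((W.LFunction ℓ : ℤ) : ZMod 3) = ((G.LFunction ℓ : ℤ) : ZMod 3)) ∧
    (∀ ℓ ∈ klSet W G, ℓ ≠ 3 → padicValInt 3 (nsCount W ℓ) = 0) ∧
    (∀ ℓ ∈ klSet G W, ℓ ≠ 3 → padicValInt 3 (nsCount G ℓ) = 0) ∧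
    padicValInt 3 (nsCount G 3) = 0

/-! ### §2. The transport kernel at a NON-SPLIT multiplicative `3` (PROVED modulo the binder KL3-A) -/

section Local

variable (W : WeierstrassCurve ℚ) [W.IsElliptic] [W.IsGloballyMinimal] (p : ℕ) [Fact p.Prime]
  {K : Type} [Field K] [NumberField K]

/-- **L1 at a multiplicative prime, local form.** At a prime `p` with `p`-unit Tamagawa number and `p ∤ #Ẽ_ns(𝔽_p)`
(every NON-SPLIT multiplicative `p`: `#Ẽ_ns = p + 1`), a point `P ∈ E(K)` with `ord_p log_ω P = 1` (and `P_ι` of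
infinite order) is NOT a `p`-th multiple in `E(ℚ_p)`: the `ℤ_p`-coordinate `Ψ(P_ι)` has valuation
`padicLogOrd + ord_p c_p + ord_p #Ẽ_ns − 1 = 0`, while `Ψ(p • Q)` has valuation `≥ 1`. The multiplicative twin of O5's
`padicPointOf_ne_nsmul_of_padicLogOrd_eq_zero` (additive: `#Ẽ_ns = p`, log order `0`).
-- adapted from Summits/BirchSwinnertonDyer/Rank1Residual/O5/HeegnerLogTransportThreeChain.lean (l. 116)
[cite: Castella2018, proof of Thm. 2.3, (calcul) (arXiv:1704.06608 p. 6)] [cite: JetchevSkinnerWan2017, (7.1.5) (p. 16)] -/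
theorem padicPointOf_ne_nsmul_of_padicLogOrd_eq_one (ι : K →+* ℚ_[p])
    (P : (W.baseChange K).toAffine.Point) (hP : ¬ IsOfFinAddOrder (padicPointOf W p ι P))
    (hc : ¬ p ∣ (W.baseChange ℚ_[p]).localTamagawaNumber ℤ_[p])
    (hns : padicValNat p (reductionPointCount W p) = 0)
    (hlog : padicLogOrd W p ι P = 1) (Q : (W.baseChange ℚ_[p]).toAffine.Point) :
    p • Q ≠ padicPointOf W p ι P := by
  haveI : ((W.baseChange ℚ_[p]).formalFiltration 2).FiniteIndex :=
    (W.baseChange ℚ_[p]).finiteIndex_formalFiltration 2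
  obtain ⟨φ, hφ⟩ := exists_addEquiv_valuation_psi_padicPointOf W p (K := K)
  intro hQ
  have hv0 : ((psi ((W.baseChange ℚ_[p]).formalFiltration 2) φ (padicPointOf W p ι P)).valuation : ℤ)
      = 0 := by
    rw [hφ ι P hP, hlog, padicValNat.eq_zero_of_not_dvd hc, hns]; norm_num
  have hQinf : ¬ IsOfFinAddOrder Q := by
    intro h
    apply hP
    rw [← hQ]
    exact h.nsmul
  have hp0 : ((p : ℕ) : ℤ) ≠ 0 := by exact_mod_cast (Fact.out : p.Prime).ne_zero
  have ht : IsOfFinAddOrder (0 : (W.baseChange ℚ_[p]).toAffine.Point) :=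
    (isOfFinAddOrder_iff_nsmul_eq_zero).mpr ⟨1, one_pos, by simp⟩
  have h1 := valuation_psi_zsmul_add ((W.baseChange ℚ_[p]).formalFiltration 2) φ hQinf ht hp0
  have h2 : ((p : ℕ) : ℤ) • Q + 0 = padicPointOf W p ι P := by rw [add_zero, natCast_zsmul, hQ]
  rw [h2] at h1
  have h3 : padicValNat p (((p : ℕ) : ℤ).natAbs) = 1 := by simp
  rw [h3] at h1
  have h4 : (psi ((W.baseChange ℚ_[p]).formalFiltration 2) φ (padicPointOf W p ι P)).valuation = 0 := by
    exact_mod_cast hv0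
  omega

/-- **L1 at a NON-SPLIT multiplicative prime, `K`-points.** `Mult W p`, not split: `#Ẽ_ns(𝔽_p) = p + 1`
(`reductionPointCount_of_mult`), so with a `p`-unit Tamagawa number a point of log order `1` is not a `p`-th multiple
of any `K`-rational point. [cite: SilvermanAEC2009, Exercise 3.5 (PDF p. 97)] -/
theorem not_nsmul_eq_of_padicLogOrd_eq_one_of_nonsplit (hmult : Mult W p)
    (hnsp : ¬ W.HasSplitMultiplicativeReductionAtPrime p) (ι : K →+* ℚ_[p])
    (P : (W.baseChange K).toAffine.Point) (hP : ¬ IsOfFinAddOrder (padicPointOf W p ι P))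
    (hc : ¬ p ∣ (W.baseChange ℚ_[p]).localTamagawaNumber ℤ_[p])
    (hlog : padicLogOrd W p ι P = 1) (Q : (W.baseChange K).toAffine.Point) :
    p • Q ≠ P := by
  intro hQ
  have hcount : reductionPointCount W p = p + 1 := (reductionPointCount_of_mult W p hmult).2 hnsp
  have hns : padicValNat p (reductionPointCount W p) = 0 := by
    rw [hcount]
    exact padicValNat.eq_zero_of_not_dvd fun h ↦
      (Fact.out : p.Prime).not_dvd_one ((Nat.dvd_add_right (dvd_refl p)).mp h)
  apply padicPointOf_ne_nsmul_of_padicLogOrd_eq_one W p ι P hP hc hns hlog (padicPointOf W p ι Q)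
  rw [← hQ]
  unfold padicPointOf
  exact (map_nsmul _ _ _).symm

end Local

/-! ### §2 (continued). The log step at a non-split `3`: KL3-A + companion-side unit ⇒ `ord₃ log_ω P = 1` -/

/-- **Kriz–Li's exponent on the corner side is `−1`.** For `W` multiplicative NON-SPLIT at `3` (`a_3 = −1`,
`|W̃^{ns}(𝔽_3)| = 4`) with unit off-`3` depletion factors: `U_W = ord₃ 4 − 1 = −1`. Bookkeeping on O5's
`klExponent_eq_of_offThree_units`. [cite: KrizLi2019, Rem. 1.17] -/
theorem klExponent_eq_neg_one_of_nonsplit (W G : WeierstrassCurve ℚ) [W.IsElliptic] [G.IsElliptic]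
    (hNW : W.conductorNorm ℤ ≠ 0) (hNG : G.conductorNorm ℤ ≠ 0)
    (hW3 : padicValInt 3 (nsCount W 3) = 0)
    (hunitW : ∀ ℓ ∈ klSet W G, ℓ ≠ 3 → padicValInt 3 (nsCount W ℓ) = 0) :
    klExponent W G = -1 := by
  rw [klExponent_eq_of_offThree_units W G (three_mem_klSet W G hNW hNG) hunitW, hW3]; norm_num

/-- At a NON-SPLIT multiplicative `3` (`a_3 = −1`) Kriz–Li's count `nsCount W 3 = 3 + [good] − a_3 ∈ {4, 5}` is a
`3`-unit: `ord₃ (nsCount W 3) = 0`. [cite: SilvermanAEC2009, Exercise 8.19(a) (p. 230)] -/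
theorem padicValInt_nsCount_three_of_nonsplit (W : WeierstrassCurve ℚ) [W.IsElliptic]
    (hmult : haveI : Fact (Nat.Prime 3) := ⟨Nat.prime_three⟩; W.HasMultiplicativeReductionAtPrime 3)
    (hnsp : haveI : Fact (Nat.Prime 3) := ⟨Nat.prime_three⟩; ¬ W.HasSplitMultiplicativeReductionAtPrime 3) :
    padicValInt 3 (nsCount W 3) = 0 := by
  haveI : Fact (Nat.Prime 3) := ⟨Nat.prime_three⟩
  have ha : W.LFunction 3 = -1 :=
    LFunction_apply_prime_of_hasMultiplicativeReductionAtPrime_of_not_split (W := W) 3 hmult hnsp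
  apply padicValInt.eq_zero_of_not_dvd
  unfold nsCount
  rw [dif_pos Nat.prime_three, ha]
  split_ifs <;> norm_num

/-- **The log step on the corner side (kernel-checked modulo KL3-A).** `W` multiplicative non-split at `3` with
`ord₃ |W̃^{ns}(𝔽_3)| = 0`, an elliptic companion `G` congruent mod `3` off `3·N_W·N_G` with unit off-`3` depletion
factors on both sides, a common Heegner field `K` (`d_K < −4`, `3 ∤ d_K`, `ι₃ : K → ℚ₃`), Manin constants `3`-units,
and the COMPANION-side unit bit `ord₃ log_{ω_G} P′ + ord₃(4 − a_3(G)) − 1 = 0`: then `ord₃ log_{ω_W} P = 1`.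
O5's `padicLogOrd_eq_zero_of_companion_unit` with the `ℓ = 3` term `−1` in place of `0`.
-- adapted from Summits/BirchSwinnertonDyer/Rank1Residual/O5/HeegnerLogTransportThreeChain.lean (l. 49)
[cite: KrizLi2019, Thm. 1.16, Rem. 1.17, §1.6] -/
theorem padicLogOrd_eq_one_of_companion_unit_of_nonsplit (hA : KrizLiUnitBitTransportThree)
    (W G : WeierstrassCurve ℚ) [W.IsElliptic] [W.IsGloballyMinimal] [G.IsElliptic] [G.IsGloballyMinimal]
    (hcong : ∀ ℓ : ℕ, ℓ.Prime → ¬ (ℓ ∣ 3 * W.conductorNorm ℤ * G.conductorNorm ℤ) →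
      ((W.LFunction ℓ : ℤ) : ZMod 3) = ((G.LFunction ℓ : ℤ) : ZMod 3))
    (hW3 : padicValInt 3 (nsCount W 3) = 0)
    (hNW : W.conductorNorm ℤ ≠ 0) (hNG : G.conductorNorm ℤ ≠ 0)
    (hunitW : ∀ ℓ ∈ klSet W G, ℓ ≠ 3 → padicValInt 3 (nsCount W ℓ) = 0)
    (hunitG : ∀ ℓ ∈ klSet G W, ℓ ≠ 3 → padicValInt 3 (nsCount G ℓ) = 0)
    {N N' : ℕ} [NeZero N] [NeZero N'] (D : ModularParametrizationData W N)
    (D' : ModularParametrizationData G N')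
    (K : Type) [Field K] [NumberField K] (hK : IsImaginaryQuadratic K)
    (hH : SatisfiesHeegnerHypothesis N K) (hH' : SatisfiesHeegnerHypothesis N' K)
    (hd : NumberField.discr K < -4) (h3d : ¬ ((3 : ℤ) ∣ NumberField.discr K))
    (H : HeegnerDatum N (NumberField.discr K)) (H' : HeegnerDatum N' (NumberField.discr K))
    (ι : K →+* ℂ) (ι₃ : K →+* ℚ_[3])
    (P : (W.baseChange K).toAffine.Point) (P' : (G.baseChange K).toAffine.Point)
    (hP : WeierstrassCurve.Affine.Point.map ι.toRatAlgHom P = heegnerPointComplex D H)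
    (hP' : WeierstrassCurve.Affine.Point.map ι.toRatAlgHom P' = heegnerPointComplex D' H')
    (hPinf : ¬ IsOfFinAddOrder P) (hP'inf : ¬ IsOfFinAddOrder P')
    (hcD : padicValInt 3 D.maninConstant = 0) (hcD' : padicValInt 3 D'.maninConstant = 0)
    (hGunit : padicLogOrd G 3 ι₃ P' + padicValInt 3 (nsCount G 3) - 1 = 0) :
    padicLogOrd W 3 ι₃ P = 1 := by
  have hiff := hA W G hcong D D' K hK hH hH' hd h3d H H' ι ι₃ P P' hP hP' hPinf hP'inf
  have hUW : klExponent W G = -1 := klExponent_eq_neg_one_of_nonsplit W G hNW hNG hW3 hunitW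
  have hUG : klExponent G W = padicValInt 3 (nsCount G 3) - 1 :=
    klExponent_eq_of_offThree_units G W (three_mem_klSet G W hNG hNW) hunitG
  have hR : klExponent G W + padicLogOrd G 3 ι₃ P' - padicValInt 3 D'.maninConstant = 0 := by
    rw [hUG, hcD']; push_cast; linarith
  have hL := hiff.mpr hR
  rw [hUW, hcD] at hL
  push_cast at hL
  linarith

/-- **The transport kernel, composed: KL3-A + companion unit bit ⇒ `3 ∤ [E(K):ℤP]` on the corner side.** Under the
hypotheses of `padicLogOrd_eq_one_of_companion_unit_of_nonsplit` and additionally `Mult W 3` non-split, a `3`-unit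
local Tamagawa number at `3`, and `E(K)[3] = 0` (on the corner: `ρ̄|_{G_K}` irreducible for `K ⊄ ℚ(E[3])`):
`ord₃ [E(K):ℤP] = 0`. What remains open is ONLY the companion-side bit (`CompanionUnitBitAt`, K2) — and the
existence of the companion (per-pair data ∕ D1). [cite: KrizLi2019, Thm. 1.16, Rem. 1.17]
[cite: Castella2018, proof of Thm. 2.3, (calcul) (arXiv:1704.06608 p. 6)] -/
theorem padicValNat_index_eq_zero_of_companion_unit_of_nonsplit (hA : KrizLiUnitBitTransportThree)
    (W G : WeierstrassCurve ℚ) [W.IsElliptic] [W.IsGloballyMinimal] [G.IsElliptic] [G.IsGloballyMinimal]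
    (hcong : ∀ ℓ : ℕ, ℓ.Prime → ¬ (ℓ ∣ 3 * W.conductorNorm ℤ * G.conductorNorm ℤ) →
      ((W.LFunction ℓ : ℤ) : ZMod 3) = ((G.LFunction ℓ : ℤ) : ZMod 3))
    (hmult : haveI : Fact (Nat.Prime 3) := ⟨Nat.prime_three⟩; Mult W 3)
    (hnsp : ¬ W.HasSplitMultiplicativeReductionAtPrime 3)
    (hNW : W.conductorNorm ℤ ≠ 0) (hNG : G.conductorNorm ℤ ≠ 0)
    (hunitW : ∀ ℓ ∈ klSet W G, ℓ ≠ 3 → padicValInt 3 (nsCount W ℓ) = 0)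
    (hunitG : ∀ ℓ ∈ klSet G W, ℓ ≠ 3 → padicValInt 3 (nsCount G ℓ) = 0)
    (hc3 : ¬ 3 ∣ (W.baseChange ℚ_[3]).localTamagawaNumber ℤ_[3])
    {N N' : ℕ} [NeZero N] [NeZero N'] (D : ModularParametrizationData W N)
    (D' : ModularParametrizationData G N')
    (K : Type) [Field K] [NumberField K] (hK : IsImaginaryQuadratic K)
    (hH : SatisfiesHeegnerHypothesis N K) (hH' : SatisfiesHeegnerHypothesis N' K)
    (hd : NumberField.discr K < -4) (h3d : ¬ ((3 : ℤ) ∣ NumberField.discr K))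
    (htors : ∀ R : (W.baseChange K).toAffine.Point, 3 • R = 0 → R = 0)
    (H : HeegnerDatum N (NumberField.discr K)) (H' : HeegnerDatum N' (NumberField.discr K))
    (ι : K →+* ℂ) (ι₃ : K →+* ℚ_[3])
    (P : (W.baseChange K).toAffine.Point) (P' : (G.baseChange K).toAffine.Point)
    (hP : WeierstrassCurve.Affine.Point.map ι.toRatAlgHom P = heegnerPointComplex D H)
    (hP' : WeierstrassCurve.Affine.Point.map ι.toRatAlgHom P' = heegnerPointComplex D' H')
    (hPinf : ¬ IsOfFinAddOrder P) (hP'inf : ¬ IsOfFinAddOrder P')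
    (hcD : padicValInt 3 D.maninConstant = 0) (hcD' : padicValInt 3 D'.maninConstant = 0)
    (hGunit : padicLogOrd G 3 ι₃ P' + padicValInt 3 (nsCount G 3) - 1 = 0) :
    padicValNat 3 (AddSubgroup.zmultiples P).index = 0 := by
  haveI : Fact (Nat.Prime 3) := ⟨Nat.prime_three⟩
  have hlog : padicLogOrd W 3 ι₃ P = 1 :=
    padicLogOrd_eq_one_of_companion_unit_of_nonsplit hA W G hcong
      (padicValInt_nsCount_three_of_nonsplit W hmult hnsp) hNW hNG hunitW hunitG D D' K hK hH hH' hd h3d H H' ι ι₃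
      P P' hP hP' hPinf hP'inf hcD hcD' hGunit
  exact padicValNat_index_zmultiples_eq_zero htors
    (not_nsmul_eq_of_padicLogOrd_eq_one_of_nonsplit W 3 hmult hnsp ι₃ P
      (not_isOfFinAddOrder_padicPointOf W 3 ι₃ P hPinf) hc3 hlog)

/-- **Frame-level reading: a companion unit bit at `K` (K2 at `K`) gives m0 for `W` at `K`** — `UnitIndexAt W K` from
`CompanionUnitBitAt G K ι₃` for a Kriz–Li companion `G` (`IsKLCompanionAtThree W G`), granted KL3-A, non-split `3`
with unit local Tamagawa number, `W(K)[3] = 0`, a Manin-unit companion datum over `K` at a level `N′` for which `K` is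
Heegner, and Gross–Zagier non-torsion of both Heegner points (hypotheses `hinf`, `hinf′`). -/
theorem unitIndexAt_of_companionUnitBit (hA : KrizLiUnitBitTransportThree)
    (W G : WeierstrassCurve ℚ) [W.IsElliptic] [W.IsGloballyMinimal] [G.IsElliptic] [G.IsGloballyMinimal]
    (hKL : IsKLCompanionAtThree W G)
    (hmult : haveI : Fact (Nat.Prime 3) := ⟨Nat.prime_three⟩; Mult W 3)
    (hnsp : ¬ W.HasSplitMultiplicativeReductionAtPrime 3)
    (hNW : W.conductorNorm ℤ ≠ 0) (hNG : G.conductorNorm ℤ ≠ 0)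
    (hc3 : ¬ 3 ∣ (W.baseChange ℚ_[3]).localTamagawaNumber ℤ_[3])
    (K : Type) [Field K] [NumberField K] (hK : IsImaginaryQuadratic K)
    (hd : NumberField.discr K < -4) (h3d : ¬ ((3 : ℤ) ∣ NumberField.discr K))
    (htors : ∀ R : (W.baseChange K).toAffine.Point, 3 • R = 0 → R = 0)
    (ι₃ : K →+* ℚ_[3]) (hbit : CompanionUnitBitAt G K ι₃)
    -- a Manin-unit companion datum over `K`, read through every complex embedding
    {N' : ℕ} [NeZero N'] (D' : ModularParametrizationData G N') (hH' : SatisfiesHeegnerHypothesis N' K)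
    (H' : HeegnerDatum N' (NumberField.discr K)) (hcD' : padicValInt 3 D'.maninConstant = 0)
    (P'of : (K →+* ℂ) → (G.baseChange K).toAffine.Point)
    (hP'of : ∀ ι : K →+* ℂ, WeierstrassCurve.Affine.Point.map ι.toRatAlgHom (P'of ι) = heegnerPointComplex D' H')
    (hinf' : ∀ ι : K →+* ℂ, ¬ IsOfFinAddOrder (P'of ι))
    -- Gross–Zagier non-torsion and Manin-unit on the `W` side (supplied by the consumer at the witness frame)
    (hinf : ∀ (N : ℕ) [NeZero N] (Dt : ModularParametrizationData W N) (H : HeegnerDatum N (NumberField.discr K))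
      (ι : K →+* ℂ) (P : (W.baseChange K).toAffine.Point), W.conductorNorm ℤ = N →
      WeierstrassCurve.Affine.Point.map ι.toRatAlgHom P = heegnerPointComplex Dt H → ¬ (3 : ℤ) ∣ Dt.c →
      ¬ IsOfFinAddOrder P ∧ padicValInt 3 Dt.maninConstant = 0 ∧ SatisfiesHeegnerHypothesis N K) :
    UnitIndexAt W K := by
  intro N _ Dt H ι P hN hP hc
  obtain ⟨hPinf, hcD, hH⟩ := hinf N Dt H ι P hN hP hc
  obtain ⟨-, hcong, hunitW, hunitG, -⟩ := hKL
  exact padicValNat_index_eq_zero_of_companion_unit_of_nonsplit hA W G hcong hmult hnsp hNW hNG hunitW hunitG hc3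
    Dt D' K hK hH hH' hd h3d htors H H' ι ι₃ P (P'of ι) hP (hP'of ι) hPinf (hinf' ι) hcD hcD'
    (hbit N' D' H' ι (P'of ι) (hP'of ι) (hinf' ι) hcD')

/-! ### §3. The BSD side on t0: the unit index at the witness frame REPLACES conjunct (L) -/

/-- `ord₃ [E(K):ℤP] = 0 ⇒ IndexLowerBoundAt W 3 K P` (left-hand side `0`). Bookkeeping; cf. the tree's
`indexLowerBoundAt_of_not_dvd_index` (which excludes the infinite index; here valuation `0` suffices). -/
theorem indexLowerBoundAt_of_padicValNat_index_eq_zero (W : WeierstrassCurve ℚ) (K : Type) [Field K]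
    [NumberField K] (P : (W.baseChange K).toAffine.Point) (h : padicValNat 3 (AddSubgroup.zmultiples P).index = 0) :
    IndexLowerBoundAt W 3 K P := by
  unfold IndexLowerBoundAt
  rw [h, mul_zero]
  exact Nat.zero_le _

/-- Projection: the doubly-unit frame IS a twist witness (conjunct (W) on t0). -/
theorem cornerTwistWitnessAt_of_witnessWithUnitIndex (W : WeierstrassCurve ℚ) [W.IsElliptic] [W.IsGloballyMinimal]
    (h : WitnessWithUnitIndexAt W) (ht0 : ¬ 3 ∣ W.tamagawaProduct) : CornerTwistWitnessAt W := by
  intro hX hns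
  obtain ⟨K, _, _, Wd, _, _, Cd, hK, hodd, hlt, hHN, hH3, hLt, hWd, hbsd, -⟩ := h hX hns ht0
  exact ⟨K, inferInstance, inferInstance, Wd, inferInstance, inferInstance, Cd, hK, hodd, hlt, hHN, hH3, hLt, hWd, hbsd⟩

/-- **The lower half `ord₃ #Ш(E)_an ≤ ord₃ #Ш(E)` on t0 from the doubly-unit frame** — replay of the tree's
`missingLowerBoundAt_of_cornerStepLAt_of_cornerTwistWitnessAt` (Replays l. 92) with the binder `hSL : CornerStepLAt W`
REPLACED by the unit index at the witness field (last argument of `missingLowerBoundAt_of_indexLowerBoundAt`: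
`IndexLowerBoundAt W 3 K P` with left-hand side `0`). Same PUBLISHED binders minus Poitou–Tate ∕ Euler–Poincaré (the
control theorem is not needed: STEP L is not invoked). CONDITIONAL on `WitnessWithUnitIndexAt W`; nothing booked.
-- adapted from Summits/BirchSwinnertonDyer/BirchSwinnertonDyer/Theorems/ClassRecordThreeCornerTwistWitnessReplays.lean (l. 92)
[cite: JetchevSkinnerWan2017, §7.4.1 (eq:shalowerK-1)–(eq:shalower), pp. 30–31] [cite: Mazur1978, Cor. 4.1]
[cite: Miller2011LMS, Def. 1.1] -/
theorem missingLowerBoundAt_of_witnessWithUnitIndex [Fact (Nat.Prime 3)]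
    (hGZ : ∀ (N : ℕ) [NeZero N] (W : WeierstrassCurve ℚ) (K : Type) [Field K] [NumberField K],
      gross_zagier N W K)
    (hKo : ∀ (N : ℕ) [NeZero N] (W : WeierstrassCurve ℚ) (K : Type) [Field K] [NumberField K],
      kolyvagin N W K)
    (hGZK : rank_eq_analyticRank_of_analyticRank_le_one) (hmod : hasEntireLFunction_rat)
    (hnf : exists_isNewformOf) (hMaz : mazur_not_dvd_maninConstant_of_odd)
    (W : WeierstrassCurve ℚ) [W.IsElliptic] [W.IsGloballyMinimal] (hX : ClassX11b W 3)
    (hns : ¬ Surj W 3) (ht0 : ¬ 3 ∣ W.tamagawaProduct) (hWU : WitnessWithUnitIndexAt W) :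
    Typed.MissingLowerBoundAt W 3 := by
  have hNS : integral_neronScaling_of_isGloballyMinimal :=
    integral_neronScaling_of_isGloballyMinimal_holds
  obtain ⟨hr, hp2, hmult, hirr⟩ := id hX
  haveI : NeZero (W.conductorNorm ℤ) := ⟨(W.conductorNorm_pos_holds).ne'⟩
  obtain ⟨K, _, _, Wd, _, _, Cd, hK, hodd, hlt, hHN, hH3, hLt, hWd, hbsd, hUI⟩ := hWU hX hns ht0
  have hpd : ¬ (3 : ℤ) ∣ NumberField.discr K := not_dvd_discr_of_split hK Nat.prime_three hp2 hH3
  have hμ : ¬ 3 ∣ Units.torsionOrder K := by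
    haveI : IsTotallyComplex K := hK.2
    rw [Literature.NumberTheory.DiophantineGeometry.torsionOrder_eq_two_of_discr_lt hK.1 hlt]
    omega
  obtain ⟨Dt, H, ι, P, hP, hc⟩ :=
    exists_maninDatum_of_odd hnf hMaz hNS W 3 (W.conductorNorm ℤ) K rfl hp2 hmult hirr hK hHN
  have htam : padicValNat 3 Wd.tamagawaProduct = padicValNat 3 W.tamagawaProduct :=
    X2.padicValNat_tamagawaProduct_twist_of_heegner_of_odd W 3 hp2 K hK hodd hpd hHN Cd hWd
  have hu : padicValRat 3 (Cd.u : ℚ) = 0 :=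
    padicValRat_u_eq_zero_of_twist_minimal W 3 K hK hHN hmult Cd hWd
  -- the twin's `≤`-half in `PPartRankZero` currency, from the supplied `BSDp Wd 3`
  have hD0 : (NumberField.discr K : ℚ) ≠ 0 := by exact_mod_cast NumberField.discr_ne_zero K
  haveI hEt : (W.quadraticTwist (NumberField.discr K : ℚ)).IsElliptic := W.isElliptic_quadraticTwist hD0
  have hLt' : (W.quadraticTwist (NumberField.discr K : ℚ)).entireLFunction = Wd.entireLFunction := by
    rw [← hWd, entireLFunction_smul]
  have hLd1 : Wd.entireLFunction 1 ≠ 0 := by rw [← hLt']; exact hLt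
  have hrd : Wd.analyticRank = 0 := (Wd.analyticRank_eq_zero_iff_holds (hmod Wd)).2 hLd1
  obtain ⟨qd, hqd, hv⟩ : PPartRankZero Wd 3 :=
    pPartRankZero_of_pPart hGZK Wd 3 hrd (pPart_of_bsdp hmod hGZK Wd 3 (by omega) hbsd)
  exact missingLowerBoundAt_of_indexLowerBoundAt W 3 (W.conductorNorm ℤ) K Dt H ι P (hGZ _ W K)
    (hKo _ W K) hGZK hmod hK hHN hP hp2 hc hμ hr hLt Wd Cd hWd hu htam ⟨qd, hqd, hv.ge⟩
    (fun _ ↦ indexLowerBoundAt_of_padicValNat_index_eq_zero W K P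
      (hUI (W.conductorNorm ℤ) Dt H ι P rfl hP hc))

/-- **The corner's missing `p`-part on t0 from the doubly-unit frame alone** — lower half by
`missingLowerBoundAt_of_witnessWithUnitIndex`, upper half = the tree's t0 branch VERBATIM (Matar–Nekovář's image-free
Kolyvagin bound over `K` + the twin's `≥`-half from `BSDp Wd 3`, `missingUpperBoundAt_of_shaIndexBound` with weight
`0`). So on t0 the route kernels need neither (L) `CornerStepLAt` nor (U′): ONE doubly-unit frame per pair. With the
transport of §2 the m0 half of that frame is the companion's unit bit (K2). CONDITIONAL on `WitnessWithUnitIndexAt W`;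
nothing booked; item 21420 does NOT close.
-- adapted from run/shared/lean/pub/bsd-stepL/corner/mult-idea-g12/Sketch.lean (l. 138, card O) and Replays (l. 198)
[cite: MatarNekovar2019, Thm. 0.3 (JTNB 31 (2019) pp. 456–457)] [cite: JetchevSkinnerWan2017, §7.4.1–7.4.2 (pp. 30–31)]
[cite: Miller2011LMS, Def. 1.1] -/
theorem missingPPartAt_of_witnessWithUnitIndex [Fact (Nat.Prime 3)]
    (hGZ : ∀ (N : ℕ) [NeZero N] (W : WeierstrassCurve ℚ) (K : Type) [Field K] [NumberField K],
      gross_zagier N W K)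
    (hKo : ∀ (N : ℕ) [NeZero N] (W : WeierstrassCurve ℚ) (K : Type) [Field K] [NumberField K],
      kolyvagin N W K)
    (hGZK : rank_eq_analyticRank_of_analyticRank_le_one) (hmod : hasEntireLFunction_rat)
    (hnf : exists_isNewformOf) (hMaz : mazur_not_dvd_maninConstant_of_odd)
    (hMN : ∀ (N : ℕ) [NeZero N] (W : WeierstrassCurve ℚ) (K : Type) [Field K] [NumberField K],
      MatarNekovar2019.thm03_padicValNat_card_sha_le_of_irreducible N W K)
    (W : WeierstrassCurve ℚ) [W.IsElliptic] [W.IsGloballyMinimal] (hX : ClassX11b W 3)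
    (hns : ¬ Surj W 3) (ht0 : ¬ 3 ∣ W.tamagawaProduct) (hWU : WitnessWithUnitIndexAt W) :
    Typed.MissingPPartAt W 3 := by
  refine Typed.missingPPartAt_of_lower_of_upper W 3
    (missingLowerBoundAt_of_witnessWithUnitIndex hGZ hKo hGZK hmod hnf hMaz W hX hns ht0 hWU) ?_
  -- upper half on t0: Matar–Nekovář + the twin's `≥`-half, at the WITNESS field (verbatim the tree's upper branch)
  have hNS : integral_neronScaling_of_isGloballyMinimal :=
    integral_neronScaling_of_isGloballyMinimal_holds
  obtain ⟨hr, hp2, hmult, hirr⟩ := id hX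
  haveI : NeZero (W.conductorNorm ℤ) := ⟨(W.conductorNorm_pos_holds).ne'⟩
  obtain ⟨K, _, _, Wd, _, _, Cd, hK, hodd, hlt, hHN, hH3, hLt, hWd, hbsd, -⟩ := hWU hX hns ht0
  have hpd : ¬ (3 : ℤ) ∣ NumberField.discr K := not_dvd_discr_of_split hK Nat.prime_three hp2 hH3
  have hμ : ¬ 3 ∣ Units.torsionOrder K := by
    haveI : IsTotallyComplex K := hK.2
    rw [Literature.NumberTheory.DiophantineGeometry.torsionOrder_eq_two_of_discr_lt hK.1 hlt]
    omega
  obtain ⟨Dt, H, ι, P, hP, hc⟩ :=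
    exists_maninDatum_of_odd hnf hMaz hNS W 3 (W.conductorNorm ℤ) K rfl hp2 hmult hirr hK hHN
  have htam : padicValNat 3 Wd.tamagawaProduct = padicValNat 3 W.tamagawaProduct :=
    X2.padicValNat_tamagawaProduct_twist_of_heegner_of_odd W 3 hp2 K hK hodd hpd hHN Cd hWd
  have hu : padicValRat 3 (Cd.u : ℚ) = 0 :=
    padicValRat_u_eq_zero_of_twist_minimal W 3 K hK hHN hmult Cd hWd
  have hD0 : (NumberField.discr K : ℚ) ≠ 0 := by exact_mod_cast NumberField.discr_ne_zero K
  haveI hEt : (W.quadraticTwist (NumberField.discr K : ℚ)).IsElliptic := W.isElliptic_quadraticTwist hD0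
  have hLt' : (W.quadraticTwist (NumberField.discr K : ℚ)).entireLFunction = Wd.entireLFunction := by
    rw [← hWd, entireLFunction_smul]
  have hLd1 : Wd.entireLFunction 1 ≠ 0 := by rw [← hLt']; exact hLt
  have hrd : Wd.analyticRank = 0 := (Wd.analyticRank_eq_zero_iff_holds (hmod Wd)).2 hLd1
  obtain ⟨qd, hqd, hvqd⟩ := exists_LOne_div_realPeriodRat_of_bsdp_rankZero hGZK hmod Wd 3 hrd hbsd
  have hD3 : NumberField.discr K ≠ -3 := by omega
  have hD4 : NumberField.discr K ≠ -4 := by omega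
  exact missingUpperBoundAt_of_shaIndexBound W 3 (W.conductorNorm ℤ) K Dt H ι P (hGZ _ W K)
    (hKo _ W K) hGZK hmod hK hHN hP hp2 hc hμ hr hLt Wd Cd hWd hu htam ht0 ⟨qd, hqd, hvqd.le⟩
    (fun _ hnt ↦ hMN _ W K hK hHN hD3 hD4 ⟨Dt, H, ι, hP⟩ hnt Nat.prime_three (by decide) hirr)

/-- **BSD(E,3) on t0 from the doubly-unit frame** — `Typed.bsdp_of_missingPPartAt` on the previous theorem (the same
final step as both route kernels). CONDITIONAL on `WitnessWithUnitIndexAt W`; nothing booked. -/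
theorem bsdp_three_of_witnessWithUnitIndex [Fact (Nat.Prime 3)]
    (hGZ : ∀ (N : ℕ) [NeZero N] (W : WeierstrassCurve ℚ) (K : Type) [Field K] [NumberField K],
      gross_zagier N W K)
    (hKo : ∀ (N : ℕ) [NeZero N] (W : WeierstrassCurve ℚ) (K : Type) [Field K] [NumberField K],
      kolyvagin N W K)
    (hGZK : rank_eq_analyticRank_of_analyticRank_le_one) (hmod : hasEntireLFunction_rat)
    (hnf : exists_isNewformOf) (hMaz : mazur_not_dvd_maninConstant_of_odd)
    (hMN : ∀ (N : ℕ) [NeZero N] (W : WeierstrassCurve ℚ) (K : Type) [Field K] [NumberField K],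
      MatarNekovar2019.thm03_padicValNat_card_sha_le_of_irreducible N W K)
    (W : WeierstrassCurve ℚ) [W.IsElliptic] [W.IsGloballyMinimal] (hX : ClassX11b W 3)
    (hns : ¬ Surj W 3) (ht0 : ¬ 3 ∣ W.tamagawaProduct) (hWU : WitnessWithUnitIndexAt W) : BSDp W 3 :=
  Typed.bsdp_of_missingPPartAt W 3 hGZK (by obtain ⟨hr, -⟩ := id hX; omega)
    (missingPPartAt_of_witnessWithUnitIndex hGZ hKo hGZK hmod hnf hMaz hMN W hX hns ht0 hWU)



end Summit.BirchSwinnertonDyer.BirchSwinnertonDyer.Cruxes.CornerAtThreeW.CompanionLogTransport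

end
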